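import Summits.BirchSwinnertonDyer.BirchSwinnertonDyer.Theorems.ByReductionTypeAtTwoOrdKatoHalfAtTwoIsoRelaxedGenuineOptimal
import Summits.BirchSwinnertonDyer.BirchSwinnertonDyer.Theorems.ByReductionTypeAtTwoOrdKatoHalfAtTwoIsoOptimalOff514OptimalMember
import HarnessLib

/-!
# Route ByReductionTypeAtTwo, crux `OrdKatoHalfAtTwoIso` (stmt-BirchSwinnertonDyer-19573), line `steinberg-fibre-at-two`:
# R-opt∃♭ — the ∃-MEMBER FLAT relaxed optimal zeta reading on the `ρ̄₂`-not-onto cell (Theorems-side text, displayed by name, and its doors)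

Seat `cruxlead-stmt-BirchSwinnertonDyer-19573-g8` (LEAD PROVER, MODE LINE; HOME `run/shared/lean/pub/bsd-2adic/`; `--supports`
stmt-BirchSwinnertonDyer-23921 `OrdKatoMuPartOptimalAtTwo` = B7′). Pen RC-434 (re-text of the registered not-onto memo stub after crux-triage
r1-2 GEN 39/40's token #60 `stub-misstated: stub_colemanHalfClass_optimal_off514`, finding M40 MEASURED, kit j328846) and RC-437 (GO: one-writer
re-assigned to the lead under D-0071). The TEXT of §1 is the lead's reconstruction of triage-2's `Cert39b.lean` §1 (item evidence #46, not mounted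
in prover jails) from the prose of `Cruxes/OrdKatoHalfAtTwoIso/TRIAGE-r1-2.md` §A(ii)/§B/§D (s93″, s96); triage-2 GEN 41 vets «text = Cert39b §1 in
meaning». HONEST FRAMING (cell bsd-2adic): BSD is not proved by any of this; the crux `OrdKatoHalfAtTwoIso` and its child B7′ (23921) are NOT
proved here; §1 is an OPEN memo-tier statement DISPLAYED BY NAME, nothing is asserted about it; every door is CONDITIONAL on the binders it
displays. Aʳ (`ArchimedeanLambdaModTwoOrdAtTwo`, w2 p705378) is displayed as `hA` for now; by pen RC-436 it is PRINT: `Aʳ = h46 ∘ ArchOfLemma46`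
with `h46 : Greenberg1999.lemma46_relaxed_mod_selmer_infinite_rat_two` (Literature, p608868) and the kernel door of audit-2's evidence #6 on
24097 (`lengthAt_selmer_add_one_le_relaxed_of_lemma46`; w2's AR-DOOR re-key in flight) — the binder is swapped when that leaf lands.

Contents: §1 `RelaxedZetaOptimalAtTwoExistsMemberFlat` (R-opt∃♭) + `_iff`; §2 `relaxedData_of_flatPackage_of_arch` (w2's
`relaxedColemanData_of_package_of_arch` with the image predicate abstracted) and `katoMuPartAtTwo_of_relaxedNeron` (the one-curve slack door
booked at `L₀` itself — NO `0 ≤ ord₂ ϖ`); §3 `katoMuPartAtOptimalMember_of_existsMemberFlat_of_arch` (B7 UNCUT from R-opt∃♭ + Aʳ + Lim@2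
upstairs + Ferrero–Washington — no Abbes–Ullmo, no modularity datum, no Greenberg 5.14) and `ordKatoMuPartOptimalAtTwo_of_existsMemberFlat_of_arch`
(child 23921 BY NAME); §4 `existsMemberFlat_of_relaxedZetaOptimal_of_AU_of_Mod` (w2's W₀-pinned GENUINE reading R-opt + AU + Mod ⇒ R-opt∃♭:
the re-text is formally WEAKER than the pinned readings it replaces).
-/

set_option autoImplicit false
set_option linter.dupNamespace false

noncomputable section

open scoped Classical MatrixGroups ModularForm NumberField
open CongruenceSubgroup WeierstrassCurve Field IsDedekindDomain NumberField
open Literature.NumberTheory.GaloisRepresentations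
open Literature.NumberTheory.GaloisCohomology
open Literature.NumberTheory.EllipticCurves Literature.NumberTheory.EllipticCurves.ModularForms
open Literature.NumberTheory.EllipticCurves.Kato2004
  Literature.NumberTheory.EllipticCurves.Kato2004.EulerSystemValues
open Literature.NumberTheory.EllipticCurves.Rank1Residual
  Summit.BirchSwinnertonDyer.Rank1Residual.X1.MuLambda
open Literature.NumberTheory.EllipticCurves.Greenberg1999
open Literature.NumberTheory.IwasawaTheory
open Summit.BirchSwinnertonDyer.Rank1Residual Summit.BirchSwinnertonDyer.Rank1Residual.X5
open Summit.BirchSwinnertonDyer.BirchSwinnertonDyer.Theorems.OrdKatoOptimalAtTwo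
  Summit.BirchSwinnertonDyer.BirchSwinnertonDyer.Theorems.OrdKatoIntAtTwo
open Summit.BirchSwinnertonDyer.BirchSwinnertonDyer.Theses.ByReductionTypeAtTwo
open Summit.BirchSwinnertonDyer.BirchSwinnertonDyer.Theorems.AlignedTransportAtTwoFineRoad

namespace Summit.BirchSwinnertonDyer.BirchSwinnertonDyer.Theorems.SteinbergFibreAtTwo

/-! ## §1 R-opt∃♭ — the ∃-member flat relaxed optimal package, Néron currency (DISPLAYED TEXT) -/

/-- [MEMO tier, OPEN — a reading, nothing asserted] **R-opt∃♭ — the ∃-MEMBER FLAT relaxed-at-`∞` Coleman half-class package at `p = 2`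
on the `ρ̄₂`-NOT-onto cell, booked in the member's OWN Néron currency.** For every non-CM globally minimal `W`, good ordinary at `2`,
`ρ̄_{W,2}` NOT onto, there is a `ℚ`-isogenous globally minimal member `W₁` such that (b) for every newform `f` of `W₁` and every `ϖ`
with `ϖ·Ω_{W₁} = Ω⁺_f` an integral lift `L₀ ∈ Λ` of `ϖ·L₂(f, α)` exists, and, for every newform `f`, the cyclotomic `(κ, γ)`, every
such `ϖ`, every relaxed Selmer dual datum `Dr` and relaxed fine datum `Yr` of `W₁`: an ideal `P ⊆ Λ`, a submodule `M ⊆ P`, an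
`ι`-semilinear column map `τ : P →ₛₗ[ι] X^{rel}` killing `M` with image `ker(X^{rel} ↠ X₀^{rel})` (`π` onto, exact), and the FLAT
image clause `s·(2^{[0 < Δ_{W₁}]}·L₀) ∈ M` (`s ∉ (2, T)`) for EVERY integral lift `L₀` of `ϖ·L₂(f, α_{W₁})` — no span clause, no
pinned member, no `0 ≤ ord₂ ϖ`. Census word s96 (crux-triage r1-2 GEN 40, kit j328846): «On the not-onto cell Kato's print-integral
zeta class lives in `T₂E•`, `E• = E₀/C₀` (C₀ = cuspidal image; [Wu14, Prop. 8] with `c₁ ∣ c₀` odd by Abbes–Ullmo); pinned at the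
X₀-optimal `E₀` the relaxed Coleman half-class package is short by `2^{LOSS(E₀)}`, `LOSS(E₀) = v₂#(C₀(2) ∩ E₀(ℝ)⁰) − j` (130 of the
394 classes with N ≤ 3000), the strict one by `2^{LOSS(E₀)+[0<Δ₀]}` (310/394); stated ∃-member (witness `E•`) it is memo-exact on every
class.» TIER: MEMO-EXACT 394/394 (witness `W₁ := E•` by Kato 12.6 + 17.5 + 17.11 + (1.3)); TRUE under IMC(E₀) + `𝐇¹`-free.
NOT in print at `2`; NOT a Literature fact; nothing asserted.
[cite: Kato2004Asterisque, Thm. 12.6 (p. 222), Thm. 16.6 (p. 271), 17.5, Prop. 17.11 (p. 277), §17.13 (pp. 279–280) (shape only; nothing asserted)]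
[cite: Wuthrich2014, Prop. 8 and p. 389 (shape only)] -/
@[conjecture] def RelaxedZetaOptimalAtTwoExistsMemberFlat : Prop :=
  ∀ (W : WeierstrassCurve ℚ) [W.IsElliptic] [W.IsGloballyMinimal],
    ¬ W.HasCM → GoodOrd W 2 → ¬ W.HasSurjectiveModNGaloisRep 2 →
    ∃ (W₁ : WeierstrassCurve ℚ) (_ : W₁.IsElliptic) (_ : W₁.IsGloballyMinimal),
      WeierstrassCurve.IsIsogenous W W₁ ∧
      (∀ [NeZero (W₁.conductorNorm ℤ)] (f : CuspForm (Gamma0 (W₁.conductorNorm ℤ)) 2),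
        IsNewformOf W₁ f → ∀ ϖ : ℚ, (ϖ : ℝ) * W₁.realPeriodRat = plusPeriod f →
          ∃ L₀ : IwasawaAlgebra 2, iwasawaToPowerSeries 2 L₀ =
            PowerSeries.C (ϖ : ℚ_[2]) * padicLFunction f (unitRoot W₁ 2 : ℚ_[2])) ∧
      ∀ {N : ℕ} [NeZero N] (f : CuspForm (Gamma0 N) 2) (κ : ZpExtension ℚ 2) (γ : absoluteGaloisGroup ℚ),
        κ.IsCyclotomic → κ.IsTopGenerator γ → IsCyclotomicVariable 2 γ → IsNewformOf W₁ f →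
        ∀ ϖ : ℚ, (ϖ : ℝ) * W₁.realPeriodRat = plusPeriod f →
        ∀ (Dr : W₁.SelmerDualDataRelaxedInf κ γ) (Yr : W₁.FineSelmerDualDataRelaxedInf κ γ),
          ∃ (P : Submodule (IwasawaAlgebra 2) (IwasawaAlgebra 2)) (M : Submodule (IwasawaAlgebra 2) P)
            (τ : P →ₛₗ[((IwasawaAlgebra.involEquiv 2).toRingEquiv : IwasawaAlgebra 2 →+* IwasawaAlgebra 2)] Dr.X)
            (π : Dr.X →ₗ[IwasawaAlgebra 2] Yr.X),
            (∀ m ∈ M, τ m = 0) ∧ Function.Surjective π ∧ Function.Exact τ π ∧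
            ∀ L₀ : IwasawaAlgebra 2,
              iwasawaToPowerSeries 2 L₀ = PowerSeries.C (ϖ : ℚ_[2]) * padicLFunction f (unitRoot W₁ 2 : ℚ_[2]) →
                ∃ s : IwasawaAlgebra 2, s ∉ IwasawaAlgebra.augIdealP 2 ∧
                  s * (PowerSeries.C (((2 : ℕ) : ℤ_[2]) ^ (if 0 < W₁.Δ then 1 else 0)) * L₀) ∈ Submodule.map P.subtype M

/-- `RelaxedZetaOptimalAtTwoExistsMemberFlat` unfolds to its displayed body. [folklore] -/
theorem relaxedZetaOptimalAtTwoExistsMemberFlat_iff : RelaxedZetaOptimalAtTwoExistsMemberFlat ↔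
    ∀ (W : WeierstrassCurve ℚ) [W.IsElliptic] [W.IsGloballyMinimal],
    ¬ W.HasCM → GoodOrd W 2 → ¬ W.HasSurjectiveModNGaloisRep 2 →
    ∃ (W₁ : WeierstrassCurve ℚ) (_ : W₁.IsElliptic) (_ : W₁.IsGloballyMinimal),
      WeierstrassCurve.IsIsogenous W W₁ ∧
      (∀ [NeZero (W₁.conductorNorm ℤ)] (f : CuspForm (Gamma0 (W₁.conductorNorm ℤ)) 2),
        IsNewformOf W₁ f → ∀ ϖ : ℚ, (ϖ : ℝ) * W₁.realPeriodRat = plusPeriod f →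
          ∃ L₀ : IwasawaAlgebra 2, iwasawaToPowerSeries 2 L₀ =
            PowerSeries.C (ϖ : ℚ_[2]) * padicLFunction f (unitRoot W₁ 2 : ℚ_[2])) ∧
      ∀ {N : ℕ} [NeZero N] (f : CuspForm (Gamma0 N) 2) (κ : ZpExtension ℚ 2) (γ : absoluteGaloisGroup ℚ),
        κ.IsCyclotomic → κ.IsTopGenerator γ → IsCyclotomicVariable 2 γ → IsNewformOf W₁ f →
        ∀ ϖ : ℚ, (ϖ : ℝ) * W₁.realPeriodRat = plusPeriod f →
        ∀ (Dr : W₁.SelmerDualDataRelaxedInf κ γ) (Yr : W₁.FineSelmerDualDataRelaxedInf κ γ),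
          ∃ (P : Submodule (IwasawaAlgebra 2) (IwasawaAlgebra 2)) (M : Submodule (IwasawaAlgebra 2) P)
            (τ : P →ₛₗ[((IwasawaAlgebra.involEquiv 2).toRingEquiv : IwasawaAlgebra 2 →+* IwasawaAlgebra 2)] Dr.X)
            (π : Dr.X →ₗ[IwasawaAlgebra 2] Yr.X),
            (∀ m ∈ M, τ m = 0) ∧ Function.Surjective π ∧ Function.Exact τ π ∧
            ∀ L₀ : IwasawaAlgebra 2,
              iwasawaToPowerSeries 2 L₀ = PowerSeries.C (ϖ : ℚ_[2]) * padicLFunction f (unitRoot W₁ 2 : ℚ_[2]) →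
                ∃ s : IwasawaAlgebra 2, s ∉ IwasawaAlgebra.augIdealP 2 ∧
                  s * (PowerSeries.C (((2 : ℕ) : ℤ_[2]) ^ (if 0 < W₁.Δ then 1 else 0)) * L₀) ∈ Submodule.map P.subtype M :=
  Iff.rfl

/-! ## §2 The one-curve slack door in NÉRON currency (no `0 ≤ ord₂ ϖ` hypothesis) -/

/-- **The relaxed data at ONE good-ordinary curve `V` from a flat package with an ARBITRARY image predicate `Φ` and Aʳ**: the
constructed relaxed datum `Dr`, the restriction `q : X^{rel} ↠ X`, the archimedean clause `ℓ₍₂₎(X) + e ≤ ℓ₍₂₎(X^{rel})` with `e = 1` on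
`0 < Δ_V` (Aʳ: `Λ/2 ↪ ker q`) and `e = 0` on `Δ_V < 0` (`q` onto), and the image clause transported verbatim for every `G` with `Φ G`.
(w2's `relaxedColemanData_of_package_of_arch` with the predicate abstracted.) [cite: GreenbergLNM1716, §4 Lemma 4.6 (PDF pp. 106–107)] -/
theorem relaxedData_of_flatPackage_of_arch (hA : ArchimedeanLambdaModTwoOrdAtTwo)
    (V : WeierstrassCurve ℚ) [V.IsElliptic] [V.IsGloballyMinimal] (hord : IsOrdinaryAt V 2)
    {κ : ZpExtension ℚ 2} {γ : absoluteGaloisGroup ℚ} (hκ : κ.IsCyclotomic)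
    (hγ : κ.IsTopGenerator γ) (D : V.SelmerDualData κ γ) (Yr : V.FineSelmerDualDataRelaxedInf κ γ)
    (Φ : IwasawaAlgebra 2 → Prop)
    (hpack : ∀ Dr : V.SelmerDualDataRelaxedInf κ γ,
      ∃ (P : Submodule (IwasawaAlgebra 2) (IwasawaAlgebra 2)) (M : Submodule (IwasawaAlgebra 2) P)
        (τ : P →ₛₗ[((IwasawaAlgebra.involEquiv 2).toRingEquiv : IwasawaAlgebra 2 →+* IwasawaAlgebra 2)] Dr.X)
        (π : Dr.X →ₗ[IwasawaAlgebra 2] Yr.X),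
        (∀ m ∈ M, τ m = 0) ∧ Function.Surjective π ∧ Function.Exact τ π ∧
        ∀ G : IwasawaAlgebra 2, Φ G →
          ∃ s : IwasawaAlgebra 2, s ∉ IwasawaAlgebra.augIdealP 2 ∧
            s * (PowerSeries.C (((2 : ℕ) : ℤ_[2]) ^ (if 0 < V.Δ then 1 else 0)) * G) ∈ Submodule.map P.subtype M) :
    ∃ (Xr : Type) (_ : AddCommGroup Xr) (_ : Module (IwasawaAlgebra 2) Xr)
      (θ : IwasawaAlgebra 2 ≃+* IwasawaAlgebra 2) (P : Submodule (IwasawaAlgebra 2) (IwasawaAlgebra 2))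
      (M : Submodule (IwasawaAlgebra 2) P)
      (τ : P →ₛₗ[(θ : IwasawaAlgebra 2 →+* IwasawaAlgebra 2)] Xr) (π : Xr →ₗ[IwasawaAlgebra 2] Yr.X) (e : ℕ),
      (∀ m ∈ M, τ m = 0) ∧ Function.Surjective π ∧ Function.Exact τ π ∧
      Module.lengthAt (IwasawaAlgebra 2) D.X
          ⟨IwasawaAlgebra.augIdealP 2, IwasawaAlgebra.isPrime_augIdealP_holds 2⟩ + e ≤
        Module.lengthAt (IwasawaAlgebra 2) Xr ⟨IwasawaAlgebra.augIdealP 2, IwasawaAlgebra.isPrime_augIdealP_holds 2⟩ ∧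
      ∀ G : IwasawaAlgebra 2, Φ G →
        ∃ s : IwasawaAlgebra 2, s ∉ IwasawaAlgebra.augIdealP 2 ∧
          s * (PowerSeries.C (((2 : ℕ) : ℤ_[2]) ^ e) * G) ∈ Submodule.map P.subtype M := by
  let Dr : V.SelmerDualDataRelaxedInf κ γ := V.selmerDualDataRelaxedInf κ hγ
  obtain ⟨q, hq⟩ := exists_relaxedSelmerRestrict V κ hγ Dr D
  have hqs := relaxedSelmerRestrict_surjective V κ Dr D q hq
  obtain ⟨P, M, τ, π, hτM, hπs, hπ, himg⟩ := hpack Dr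
  refine ⟨Dr.X, inferInstance, inferInstance, (IwasawaAlgebra.involEquiv 2).toRingEquiv, P, M, τ, π,
    (if 0 < V.Δ then 1 else 0), hτM, hπs, hπ, ?_, himg⟩
  by_cases hΔ : 0 < V.Δ
  · obtain ⟨j, hj⟩ := hA V κ γ hκ hord hΔ hγ D Dr q hq
    rw [if_pos hΔ]
    exact lengthAt_add_one_le_of_archExtension q hqs j hj
  · rw [if_neg hΔ, Nat.cast_zero, add_zero]
    exact Module.lengthAt_le_of_surjective q hqs _

/-- **`X5.O1.KatoMuPartAtTwo W′` at ONE curve — ANY image of `ρ̄₂` — from relaxed data booked in NÉRON currency**: for every newform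
`f`, the cyclotomic data, every Néron ratio `ϖ` (`ϖ·Ω_{W′} = Ω⁺_f`), every `D` and `Yr`, SOME relaxed module `Xr` with the flat package,
exponent `e`, archimedean clause and the image clause `s·(2^e·L₀) ∈ M` for EVERY integral lift `L₀` of `ϖ·L₂(f, α)`; plus relaxed (A₂)
«`ℓ₍₂₎(Yr.X) = 0`». Then `2^{μ(X)} ∣ 2^{μ(L₀)} ∣ L₀` (w2's `mu_le_mu_of_relaxedColemanSemilinear_of_arch` at `G := L₀`). Compared with
w2's `katoMuPartAtTwo_of_relaxedColeman_of_integralRatio` there is NO `0 ≤ ord₂ ϖ` hypothesis: the booking is at `L₀` itself.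
[cite: Kato2004Asterisque, §17.13 (pp. 279–280) (shape)] [cite: GreenbergLNM1716, §1 p. 60, p. 170 (shape)] [cite: MazurTateTeitelbaum1986Invent, §I.12] -/
theorem katoMuPartAtTwo_of_relaxedNeron (W' : WeierstrassCurve ℚ) [W'.IsElliptic] [W'.IsGloballyMinimal]
    (hR : ∀ {N : ℕ} [NeZero N] (f : CuspForm (Gamma0 N) 2) (κ : ZpExtension ℚ 2) (γ : absoluteGaloisGroup ℚ),
      κ.IsCyclotomic → κ.IsTopGenerator γ → IsCyclotomicVariable 2 γ → IsOrdinaryAt W' 2 → IsNewformOf W' f →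
      ∀ ϖ : ℚ, (ϖ : ℝ) * W'.realPeriodRat = plusPeriod f →
      ∀ (D : W'.SelmerDualData κ γ) (Yr : W'.FineSelmerDualDataRelaxedInf κ γ),
        ∃ (Xr : Type) (_ : AddCommGroup Xr) (_ : Module (IwasawaAlgebra 2) Xr)
          (θ : IwasawaAlgebra 2 ≃+* IwasawaAlgebra 2) (P : Submodule (IwasawaAlgebra 2) (IwasawaAlgebra 2))
          (M : Submodule (IwasawaAlgebra 2) P)
          (τ : P →ₛₗ[(θ : IwasawaAlgebra 2 →+* IwasawaAlgebra 2)] Xr) (π : Xr →ₗ[IwasawaAlgebra 2] Yr.X) (e : ℕ),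
          (∀ m ∈ M, τ m = 0) ∧ Function.Surjective π ∧ Function.Exact τ π ∧
          Module.lengthAt (IwasawaAlgebra 2) D.X
              ⟨IwasawaAlgebra.augIdealP 2, IwasawaAlgebra.isPrime_augIdealP_holds 2⟩ + e ≤
            Module.lengthAt (IwasawaAlgebra 2) Xr ⟨IwasawaAlgebra.augIdealP 2, IwasawaAlgebra.isPrime_augIdealP_holds 2⟩ ∧
          ∀ L₀ : IwasawaAlgebra 2,
            iwasawaToPowerSeries 2 L₀ = PowerSeries.C (ϖ : ℚ_[2]) * padicLFunction f (unitRoot W' 2 : ℚ_[2]) →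
            ∃ s : IwasawaAlgebra 2, s ∉ IwasawaAlgebra.augIdealP 2 ∧
              s * (PowerSeries.C (((2 : ℕ) : ℤ_[2]) ^ e) * L₀) ∈ Submodule.map P.subtype M)
    (hAr : ∀ (κ : ZpExtension ℚ 2) (γ : absoluteGaloisGroup ℚ), κ.IsCyclotomic → κ.IsTopGenerator γ →
      ∀ Yr : W'.FineSelmerDualDataRelaxedInf κ γ,
        Module.lengthAt (IwasawaAlgebra 2) Yr.X ⟨IwasawaAlgebra.augIdealP 2, IwasawaAlgebra.isPrime_augIdealP_holds 2⟩ = 0) :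
    O1.KatoMuPartAtTwo W' := by
  intro κ γ hκ hγ hγ' hord _ f hf ϖ hϖf D L₀ hL₀
  obtain ⟨Yr⟩ := W'.nonempty_fineSelmerDualDataRelaxedInf κ hγ
  obtain ⟨Xr, _, _, θ, P, M, τ, π, e, hτM, -, hπ, harch, himg⟩ := hR f κ γ hκ hγ hγ' hord hf ϖ hϖf D Yr
  by_cases hL0 : L₀ = 0
  · rw [hL0]; exact dvd_zero _
  have hμ : D.mu ≤ mu L₀ :=
    mu_le_mu_of_relaxedColemanSemilinear_of_arch (D := D) hL0 θ P M τ π hτM hπ (himg L₀ hL₀) harch (hAr κ γ hκ hγ Yr)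
  calc (PowerSeries.C (((2 : ℕ) : ℤ_[2]) ^ D.mu) : IwasawaAlgebra 2)
      ∣ PowerSeries.C (((2 : ℕ) : ℤ_[2]) ^ mu L₀) := map_dvd _ (pow_dvd_pow _ hμ)
    _ ∣ L₀ := C_pow_mu_dvd hL0

/-! ## §3 B7 UNCUT and child 23921 BY NAME from R-opt∃♭ + Aʳ + Lim@2 upstairs + Ferrero–Washington (NO AU, NO modularity, NO 5.14) -/

/-- **B7 `KatoMuPartAtOptimalMemberOfNotSurjectiveTwo` (UNCUT) BY NAME from R-opt∃♭ (memo-exact ∃-member flat relaxed package),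
Aʳ (archimedean `Λ/2`, print-derived) and TWO PRINT facts BY NAME: Lim 2017 Thm. 3.5 at `2` UPSTAIRS and Ferrero–Washington** (relaxed
(A₂) at the witness member, which is not onto along the isogeny: `not_hasSurjectiveModNGaloisRep_two_of_isIsogenous`). Witness `W′ := W₁`
(the ∃-member of R-opt∃♭; intended `E• = E₀/C₀`); its `μ`-part by §2 with the relaxed data of `relaxedData_of_flatPackage_of_arch` at the
predicate `Φ L₀ :≡ ι L₀ = ϖ·L₂(f, α_{W₁})`; clause (b) is the ∃-member text's own. NO Abbes–Ullmo, NO modularity datum, NO Greenberg 5.14.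
CONDITIONAL; nothing closed. [cite: Lim2017FineSelmer, §3 Thm. 3.5 and Lemma 3.2] [cite: FerreroWashington1979, Theorem]
[cite: Kato2004Asterisque, §17.13 (pp. 279–280) (shape; nothing asserted)] -/
theorem katoMuPartAtOptimalMember_of_existsMemberFlat_of_arch
    (hLim : Lim2017.thm35_at_two_upstairs_fineSelmer_twoTorsion_finite_of_classicalMuVanishes)
    (hFW : ferreroWashington1979_classicalMuVanishes)
    (hR : RelaxedZetaOptimalAtTwoExistsMemberFlat) (hA : ArchimedeanLambdaModTwoOrdAtTwo) :
    KatoMuPartAtOptimalMemberOfNotSurjectiveTwo := by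
  intro W _ _ hcm hgo hns
  obtain ⟨W₁, _, _, hiso, hb, hpack⟩ := hR W hcm hgo hns
  have hns₁ : ¬ W₁.HasSurjectiveModNGaloisRep 2 := not_hasSurjectiveModNGaloisRep_two_of_isIsogenous W hns hiso
  refine ⟨W₁, ‹_›, ‹_›, hiso, ?_, hb⟩
  refine katoMuPartAtTwo_of_relaxedNeron W₁ (fun f κ γ hκ hγ hγ' hord hf ϖ hϖ D Yr ↦ ?_)
    (fun κ γ hκ hγ Yr ↦
      lengthAt_fineRelaxed_eq_zero_of_not_hasSurjectiveModNGaloisRep_of_limUpstairs_of_FW hLim hFW W₁ hns₁ hκ hγ Yr)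
  exact relaxedData_of_flatPackage_of_arch hA W₁ hord hκ hγ D Yr
    (fun L₀ ↦ iwasawaToPowerSeries 2 L₀ = PowerSeries.C (ϖ : ℚ_[2]) * padicLFunction f (unitRoot W₁ 2 : ℚ_[2]))
    (fun Dr ↦ hpack f κ γ hκ hγ hγ' hf ϖ hϖ Dr Yr)

/-- **The route's child `OrdKatoMuPartOptimalAtTwo` (stmt-BirchSwinnertonDyer-23921, text = B7′ verbatim) BY NAME from R-opt∃♭, Aʳ,
Lim@2 upstairs and Ferrero–Washington** (B7 ⇒ B7′ by `katoMuPartOff514_of_katoMuPartAtOptimalMember`, left disjunct; Greenberg 5.14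
NOT consumed). CONDITIONAL; the item is NOT closed by this; nothing asserted. [cite: Lim2017FineSelmer, §3 Thm. 3.5] [cite: FerreroWashington1979, Theorem] -/
theorem ordKatoMuPartOptimalAtTwo_of_existsMemberFlat_of_arch
    (hLim : Lim2017.thm35_at_two_upstairs_fineSelmer_twoTorsion_finite_of_classicalMuVanishes)
    (hFW : ferreroWashington1979_classicalMuVanishes)
    (hR : RelaxedZetaOptimalAtTwoExistsMemberFlat) (hA : ArchimedeanLambdaModTwoOrdAtTwo) :
    OrdKatoMuPartOptimalAtTwo :=
  katoMuPartOff514_of_katoMuPartAtOptimalMember (katoMuPartAtOptimalMember_of_existsMemberFlat_of_arch hLim hFW hR hA)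

/-! ## §4 Monotonicity: the pinned GENUINE reading R-opt (w2 p706741) + Abbes–Ullmo + modularity ⇒ R-opt∃♭ (the repair is formally weaker) -/

/-- **R-opt + Abbes–Ullmo + modularity ⇒ R-opt∃♭** — the witness is the lattice-optimal member `W₁ := W₀`
(`exists_isIsogenous_latticeOptimal`), clause (b) is print there (`hint_two_of_latticeOptimal_of_abbesUllmo`), `M := ℓ(Z)` (the GENUINE span
clause is dropped), and every integral lift `L₀` of `ϖ·L₂` is `C(ϖ₀)·G₁` with `ι G₁ = L₂` and `ϖ₀ ∈ ℤ₂` (`ord₂ ϖ = 0` at `W₀` by Abbes–Ullmo),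
so the image clause at `2^e·G₁` gives the one at `2^e·L₀` inside the submodule `ℓ(Z)`. So the ∃-member text asks LESS than the registered
pinned readings. [cite: AbbesUllmo1996, Thm. A] [cite: EdixhovenManin1991, Prop. 2] [cite: MazurTateTeitelbaum1986Invent, §I.12] -/
theorem existsMemberFlat_of_relaxedZetaOptimal_of_AU_of_Mod
    (hAU : abbesUllmo_not_dvd_maninConstant_of_not_dvd_level) (hMod : nonempty_modularParametrizationData)
    (hRopt : RelaxedZetaColemanIotaOptimalAtTwo) : RelaxedZetaOptimalAtTwoExistsMemberFlat := by
  intro W _ _ hcm hgo hns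
  obtain ⟨W₀, _, _, N₀, _, D₀, hiso, hopt⟩ := exists_isIsogenous_latticeOptimal hMod W
  haveI : ContinuousSMul ℤ_[2] (W₀.tateModule 2) := TateModule.continuousSMul_padicInt
  haveI : Module.Free ℤ_[2] (W₀.tateModule 2) := W₀.module_free_tateModule_holds 2
  haveI : Module.Finite ℤ_[2] (W₀.tateModule 2) := W₀.module_finite_tateModule_holds 2
  have hgo₀ : GoodOrd W₀ 2 := goodOrd_two_of_isIsogenous W hiso hgo
  refine ⟨W₀, ‹_›, ‹_›, hiso, fun f hf ϖ hϖ ↦ hint_two_of_latticeOptimal_of_abbesUllmo hAU W₀ hgo₀ D₀ hopt f hf ϖ hϖ, ?_⟩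
  intro N _ f κ γ hκ hγ hγ' hf ϖ hϖ Dr Yr
  obtain ⟨I, Z, P, ℓ, τ, π, -, hτℓ, hπs, hπ, himg⟩ := hRopt W hcm hgo hns W₀ D₀ hiso hopt f κ γ hκ hγ hγ' hf Dr Yr
  refine ⟨P, Submodule.map ℓ Z, τ, π, ?_, hπs, hπ, fun L₀ hL₀ ↦ ?_⟩
  · rintro _ ⟨z, hz, rfl⟩
    exact hτℓ z hz
  -- `L₂(f, α) = ι G₁` (INT2-AUTO), `L₀ = C(ϖ₀)·G₁` with `ϖ₀ ∈ ℤ₂` (Abbes–Ullmo at the optimal member)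
  obtain ⟨G₁, hG₁⟩ := exists_iwasawaToPowerSeries_eq_padicLFunction_two_auto (W := W₀) (f := f) ⟨hgo₀.1, hgo₀.2⟩ hf
  have hv : 0 ≤ padicValRat 2 ϖ :=
    (padicValRat_two_neronRatio_eq_zero_of_latticeOptimal_of_abbesUllmo hAU W₀ hgo₀.1 D₀ hopt f hf ϖ hϖ).ge
  have hnorm : ‖((ϖ : ℚ) : ℚ_[2])‖ ≤ 1 := by
    by_cases h0 : ϖ = 0
    · subst h0; simp
    have hϖQ : ((ϖ : ℚ) : ℚ_[2]) ≠ 0 := by exact_mod_cast h0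
    rw [Padic.norm_eq_zpow_neg_valuation hϖQ, Padic.valuation_ratCast]
    exact zpow_le_one_of_nonpos₀ (by norm_num) (by linarith)
  let ϖ₀ : ℤ_[2] := ⟨((ϖ : ℚ) : ℚ_[2]), hnorm⟩
  have hL₀G : L₀ = (PowerSeries.C ϖ₀ : IwasawaAlgebra 2) * G₁ := by
    apply iwasawaToPowerSeries_injective 2
    rw [hL₀, map_mul, hG₁, iwasawaToPowerSeries, PowerSeries.map_C]
    rfl
  obtain ⟨s, hs, hsG⟩ := himg G₁ hG₁
  refine ⟨s, hs, ?_⟩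
  have hmem : (PowerSeries.C ϖ₀ : IwasawaAlgebra 2) •
      (s * (PowerSeries.C (((2 : ℕ) : ℤ_[2]) ^ (if 0 < W₀.Δ then 1 else 0)) * G₁)) ∈
        Submodule.map (P.subtype ∘ₗ ℓ) Z := Submodule.smul_mem _ _ hsG
  have heq : s * (PowerSeries.C (((2 : ℕ) : ℤ_[2]) ^ (if 0 < W₀.Δ then 1 else 0)) * L₀) =
      (PowerSeries.C ϖ₀ : IwasawaAlgebra 2) •
        (s * (PowerSeries.C (((2 : ℕ) : ℤ_[2]) ^ (if 0 < W₀.Δ then 1 else 0)) * G₁)) := by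
    rw [hL₀G, smul_eq_mul]; ring
  rw [heq, ← Submodule.map_comp]
  exact hmem

end Summit.BirchSwinnertonDyer.BirchSwinnertonDyer.Theorems.SteinbergFibreAtTwo

end
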